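import Literature.AlgebraicGeometry.HodgeTheory.HermitianFormEigenspaceNondegenerate
import HarnessLib

/-!
# `B_ℂ` pairs `H(ζ^a)` perfectly with `H(ζ^{p−a})` (Carlson–Toledo 1999 §2: "`H(μ)` is paired with `H(μ̄)`")
# — lane D, hole S6 (the duality block of the section)

Family `hodge`, layer `Literature/AlgebraicGeometry/HodgeTheory`. THEOREMS only, for crux K1 of
`Summits/HodgeConjecture/HodgeConjecture/Theses/CyclicUnitaryPowers.lean` (lane D glue, hole S6: on
`E'_i = H(ζ^(p−1−i))` the section acts by the `B_ℂ`-adjoint-inverse of the `E_i`-block, which requires the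
pairing `B_ℂ : H(ζ^a) × H(ζ^(p−a)) → ℂ` to be perfect).  Since `B_ℂ(H(μ), H(μ')) = 0` unless `μμ' = 1`
(`baseChange_eq_zero_of_mem_eigenspace`), `V ⊗ ℂ = ⊕_m H(ζ^m)` (the eigenprojectors) and `B_ℂ` is non-degenerate,
a vector of `H(ζ^a)` orthogonal to `H(ζ^(p−a))` is orthogonal to everything, hence zero; symmetrically on the
other side.  An element of `GL(V ⊗ ℂ)` preserving `B_ℂ` and the eigenspaces is therefore determined on `H(ζ^(p−a))`
by its action on `H(ζ^a)` (`apply_eq_of_isometry_of_forall_mem`).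
Written by the prover seat `hodge-nonav-prover-Ax`.

## References
* [CarlsonToledo1999] J. A. Carlson, D. Toledo, Duke Math. J. 97 (1999), §2 (p. 5), §5 (p. 11).
-/

noncomputable section

open Module Literature.AlgebraicGeometry.Motives
open scoped TensorProduct ComplexConjugate

namespace Literature.AlgebraicGeometry.HodgeTheory

universe v

variable {V : Type v} [AddCommGroup V] [Module ℚ V]

/-- `ζ^a · ζ^m = 1` with `a, m < p` forces `m = p − a` (for `1 ≤ a`) — the index of the dual eigenspace.
[cite: CarlsonToledo1999, §2 (p. 5)] -/
theorem pow_mul_pow_ne_one_of_ne {p : ℕ} {ζ : ℂ} (hζ : IsPrimitiveRoot ζ p) {a m : ℕ} (ha1 : 1 ≤ a)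
    (hap : a < p) (hm : m < p) (hma : m ≠ p - a) : ζ ^ a * ζ ^ m ≠ 1 := by
  intro h1
  apply hma
  refine hζ.pow_inj hm (by omega) ?_
  have h2 : ζ ^ (p - a) * ζ ^ a = 1 := by rw [← pow_add, Nat.sub_add_cancel hap.le, hζ.pow_eq_one]
  calc ζ ^ m = (ζ ^ a)⁻¹ := eq_inv_of_mul_eq_one_right h1
    _ = ζ ^ (p - a) := (eq_inv_of_mul_eq_one_left h2).symm

/-- For `x ∈ H(ζ^a)`: `B_ℂ(x, y) = B_ℂ(x, π_{p−a} y)` — only the `H(ζ^(p−a))`-component of `y` pairs with `x`.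
[cite: CarlsonToledo1999, §2 (p. 5)] -/
theorem baseChange_eq_cyclicEigenProjector_right {τ : V →ₗ[ℚ] V} {p : ℕ} (hτ : τ ^ p = 1) {ζ : ℂ}
    (hζ : IsPrimitiveRoot ζ p) (hp : 0 < p) {B : LinearMap.BilinForm ℚ V} (hτB : ∀ v w, B (τ v) (τ w) = B v w)
    {a : ℕ} (ha1 : 1 ≤ a) (hap : a < p) {x : ℂ ⊗[ℚ] V} (hx : x ∈ Module.End.eigenspace (τ.baseChange ℂ) (ζ ^ a))
    (y : ℂ ⊗[ℚ] V) : B.baseChange ℂ x y = B.baseChange ℂ x (cyclicEigenProjector τ p ζ (p - a) y) := by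
  have hζ0 : ζ ≠ 0 := hζ.ne_zero hp.ne'
  conv_lhs => rw [← sum_cyclicEigenProjector (τ := τ) hζ hp y]
  rw [map_sum, Finset.sum_eq_single (p - a)]
  · intro m hm hma
    exact baseChange_eq_zero_of_mem_eigenspace hτB (pow_mul_pow_ne_one_of_ne hζ ha1 hap (Finset.mem_range.1 hm) hma)
      hx (cyclicEigenProjector_mem_eigenspace hτ hζ.pow_eq_one hζ0 m y)
  · intro h
    exact absurd (Finset.mem_range.2 (by omega)) h

/-- **Perfect pairing, left**: a vector of `H(ζ^a)` that is `B_ℂ`-orthogonal to `H(ζ^(p−a))` vanishes (`B`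
symmetric non-degenerate, `V` finite-dimensional, `1 ≤ a < p`). [cite: CarlsonToledo1999, §2 (p. 5)] -/
theorem eq_zero_of_mem_eigenspace_of_forall_baseChange_eq_zero [Module.Finite ℚ V] {τ : V →ₗ[ℚ] V} {p : ℕ}
    (hτ : τ ^ p = 1) {ζ : ℂ} (hζ : IsPrimitiveRoot ζ p) (hp : 0 < p) {B : LinearMap.BilinForm ℚ V} (hB : B.IsSymm)
    (hBn : B.Nondegenerate) (hτB : ∀ v w, B (τ v) (τ w) = B v w) {a : ℕ} (ha1 : 1 ≤ a) (hap : a < p)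
    {x : ℂ ⊗[ℚ] V} (hx : x ∈ Module.End.eigenspace (τ.baseChange ℂ) (ζ ^ a))
    (h0 : ∀ y ∈ Module.End.eigenspace (τ.baseChange ℂ) (ζ ^ (p - a)), B.baseChange ℂ x y = 0) : x = 0 := by
  have hζ0 : ζ ≠ 0 := hζ.ne_zero hp.ne'
  refine eq_zero_of_forall_baseChange_eq_zero hB hBn x fun y => ?_
  rw [baseChange_eq_cyclicEigenProjector_right hτ hζ hp hτB ha1 hap hx y]
  exact h0 _ (cyclicEigenProjector_mem_eigenspace hτ hζ.pow_eq_one hζ0 _ y)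

/-- **An isometry preserving the eigenspaces is determined on `H(ζ^(p−a))` by its values on `H(ζ^a)`**: if
`θ, θ'` preserve `B_ℂ`, agree on `H(ζ^a)`, and map `H(ζ^(p−a))` into itself, then they agree on `H(ζ^(p−a))`
(`1 ≤ a < p`; uses the perfect pairing with the roles of `a` and `p − a` exchanged).
[cite: CarlsonToledo1999, §2 (p. 5)] -/
theorem apply_eq_of_isometry_of_forall_mem [Module.Finite ℚ V] {τ : V →ₗ[ℚ] V} {p : ℕ} (hτ : τ ^ p = 1) {ζ : ℂ}
    (hζ : IsPrimitiveRoot ζ p) (hp : 0 < p) {B : LinearMap.BilinForm ℚ V} (hB : B.IsSymm) (hBn : B.Nondegenerate)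
    (hτB : ∀ v w, B (τ v) (τ w) = B v w) {a : ℕ} (ha1 : 1 ≤ a) (hap : a < p)
    {θ θ' : ℂ ⊗[ℚ] V ≃ₗ[ℂ] ℂ ⊗[ℚ] V}
    (hθ : ∀ x y, B.baseChange ℂ (θ x) (θ y) = B.baseChange ℂ x y)
    (hθ' : ∀ x y, B.baseChange ℂ (θ' x) (θ' y) = B.baseChange ℂ x y)
    (hagree : ∀ x ∈ Module.End.eigenspace (τ.baseChange ℂ) (ζ ^ a), θ x = θ' x)
    (hsurj : ∀ x ∈ Module.End.eigenspace (τ.baseChange ℂ) (ζ ^ a), ∃ x' ∈ Module.End.eigenspace (τ.baseChange ℂ) (ζ ^ a), θ x' = x)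
    (hθE : ∀ y ∈ Module.End.eigenspace (τ.baseChange ℂ) (ζ ^ (p - a)), θ y ∈ Module.End.eigenspace (τ.baseChange ℂ) (ζ ^ (p - a)))
    (hθ'E : ∀ y ∈ Module.End.eigenspace (τ.baseChange ℂ) (ζ ^ (p - a)), θ' y ∈ Module.End.eigenspace (τ.baseChange ℂ) (ζ ^ (p - a)))
    {y : ℂ ⊗[ℚ] V} (hy : y ∈ Module.End.eigenspace (τ.baseChange ℂ) (ζ ^ (p - a))) : θ y = θ' y := by
  -- `θ y - θ' y ∈ H(ζ^(p-a))` is orthogonal to `H(ζ^a) = H(ζ^(p-(p-a)))`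
  have hpa1 : 1 ≤ p - a := by omega
  have hpap : p - a < p := by omega
  have hsub : θ y - θ' y ∈ Module.End.eigenspace (τ.baseChange ℂ) (ζ ^ (p - a)) :=
    Submodule.sub_mem _ (hθE y hy) (hθ'E y hy)
  rw [← sub_eq_zero]
  refine eq_zero_of_mem_eigenspace_of_forall_baseChange_eq_zero hτ hζ hp hB hBn hτB hpa1 hpap hsub fun z hz => ?_
  rw [Nat.sub_sub_self hap.le] at hz
  obtain ⟨x', hx', rfl⟩ := hsurj z hz
  rw [map_sub, LinearMap.sub_apply, sub_eq_zero]
  -- `B_ℂ(θ y, θ x') = B_ℂ(y, x') = B_ℂ(θ' y, θ' x') = B_ℂ(θ' y, θ x')`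
  rw [hθ, ← hθ' y x', ← hagree x' hx']

end Literature.AlgebraicGeometry.HodgeTheory

end
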